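import Mathlib
import Summits.Ventures.PercRepro.PuncturedLYMUnif33Num1

/-!
# PercRepro — (SP) FOR ANY NUMBER OF PAIRWISE DISJOINT `3`-SETS AT LEVEL `3`: THE SYMBOLIC TABLE IN `(n, k)`
(p10, gen 40)

The denominator factors `Qp`, `Pp`, the cardinalities `Yc = #Y`, `Pc = #P` as polynomials, the selector of the numerators by class and direction, and the unnormalised weight `raw`.  Nothing here asserts (SP).
-/

namespace PercRepro.PuncturedLYM.Split.TypeLift.Unif33

/-- `Qp`, the second factor of the common denominator. -/
def Qp (n _k : ℚ) : ℚ := 3 * n - 1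

/-- `Pp = n(n−1)⋯(n−2) − 6 k`, the first factor of the common denominator. -/
def Pp (n k : ℚ) : ℚ := n ^ 3 - 3 * n ^ 2 + 2 * n - 6 * k

/-- `#Y = C(n, 4)` as a polynomial in `n`. -/
def Yc (n : ℚ) : ℚ := (1 / 24) * n ^ 4 + (-1 / 4) * n ^ 3 + (11 / 24) * n ^ 2 + (-1 / 4) * n

/-- `#P = C(n, 3) − k C(n − 3, 0)` as a polynomial in `n` and `k`. -/
def Pc (n k : ℚ) : ℚ := (1 / 6) * n ^ 3 + (-1 / 2) * n ^ 2 + (1 / 3) * n - k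

/-- The numerators of the class `(0, 0)` by direction. -/
def sel_00 (v : ℕ) (n k : ℚ) : ℚ :=
  if v = 0 then N_00_D0 n k else
  if v = 3 then N_00_F n k else
  0

/-- The numerators of the class `(1, 0)` by direction. -/
def sel_10 (v : ℕ) (n k : ℚ) : ℚ :=
  if v = 0 then N_10_D0 n k else
  if v = 1 then N_10_D1 n k else
  if v = 3 then N_10_F n k else
  0

/-- The numerators of the class `(0, 1)` by direction. -/
def sel_01 (v : ℕ) (n k : ℚ) : ℚ :=
  if v = 0 then N_01_D0 n k else
  if v = 3 then N_01_F n k else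
  0

/-- The numerators of the class `(2, 0)` by direction. -/
def sel_20 (v : ℕ) (n k : ℚ) : ℚ :=
  if v = 0 then N_20_D0 n k else
  if v = 1 then N_20_D1 n k else
  if v = 3 then N_20_F n k else
  0

/-- The numerators of the class `(1, 1)` by direction. -/
def sel_11 (v : ℕ) (n k : ℚ) : ℚ :=
  if v = 0 then N_11_D0 n k else
  if v = 1 then N_11_D1 n k else
  if v = 3 then N_11_F n k else
  0

/-- The numerators of the class `(3, 0)` by direction. -/
def sel_30 (v : ℕ) (n k : ℚ) : ℚ :=
  if v = 0 then N_30_D0 n k else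
  if v = 1 then N_30_D1 n k else
  if v = 3 then N_30_F n k else
  0

/-- The numerator selected by the class `(c1, …, c2)` and the direction `v`; `0` outside the table. -/
def sel (c1 c2 v : ℕ) (n k : ℚ) : ℚ :=
  if c1 = 0 ∧ c2 = 0 then sel_00 v n k else
  if c1 = 1 ∧ c2 = 0 then sel_10 v n k else
  if c1 = 0 ∧ c2 = 1 then sel_01 v n k else
  if c1 = 2 ∧ c2 = 0 then sel_20 v n k else
  if c1 = 1 ∧ c2 = 1 then sel_11 v n k else
  if c1 = 3 ∧ c2 = 0 then sel_30 v n k else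
  0

/-- The unnormalised weight of a class towards a direction: column sums `1`, row sums `#Y / #P`. -/
def raw (n k : ℚ) (c1 c2 v : ℕ) : ℚ := sel c1 c2 v n k / (12 * Pp n k * Qp n k)

end PercRepro.PuncturedLYM.Split.TypeLift.Unif33
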